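import Literature.MathematicalPhysics.QuantumLattice.HubbardTorus2DTiling
import Literature.MathematicalPhysics.QuantumLattice.HubbardOneParticleCost
import Literature.MathematicalPhysics.QuantumLattice.SquareTilingLimit
import HarnessLib

/-!
# The thermodynamic limit of the ground-state energy density of the Hubbard model on the
# two-dimensional torus

Trunk T-QLATTICE (family `hubbard`). For the Hubbard Hamiltonian `hamiltonian G t U` on the tori
`ℤ/Lℤ × ℤ/Lℤ` (`fermionRectTorusGraph L L ≅ fermionTorusGraph 2 L`, `HubbardRectangularTorus.lean`)
with repulsion `U ≥ 0`, the canonical ground-state energy per site at density `n ∈ [0, 2)`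
(electrons per site), `E_{L×L}(N_L(n))/L²` with `N_L(n) = 2⌊nL²/2⌋` (`rectN`), converges as
`L → ∞` (`tendsto_groundEnergyAt_square_div_sq`); the limit is `energyDensity2D t U n`
(`tendsto_energyDensity2D`, `tendsto_energyDensity2D_torus`), and it is an infimum in the sense
of the finite-size **tiling lower bound** `energyDensity2D_le`:
`e(2m/L²) ≤ E_{L×L}(2m)/L² + 16|t|/L` for every `L ≥ 1` and even `2m < 2L²`.

Proof: Fekete along squares (`tendsto_of_tiling_of_filling`) fed by the tiling and filling
inequalities of `HubbardTorus2DTiling.lean`, the rounding of the density being absorbed by the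
volume-uniform one-particle addition cost of `HubbardOneParticleCost.lean`
(`groundEnergyAt_add_le`: a particle added below density `ν` per orbital costs `≤ K/(1-ν)`) —
Ruelle, *Statistical Mechanics* (1969), §2.2, §3.3–3.4, for the 2D Hubbard model on tori; the
`T = 0` canonical input of `TwPureThermalBound` (route `HubbardSuperconductivity/ThermalWedge`).
Convexity in `n`: `HubbardTorus2DEnergyDensityConvex.lean`. Definitions: `rectN`,
`energyDensity2D` (a `limUnder`, used through its `Tendsto` theorem), `addCost`.
Sources: D. Ruelle, op. cit.; E. H. Lieb, F. Y. Wu, PRL 20 (1968) 1445 (`e(ρ)` of the Hubbard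
model as a thermodynamic limit). [cite: Ruelle1969, §3.3]
-/

noncomputable section

namespace Literature.MathematicalPhysics.QuantumLattice

open Matrix Finset Filter Topology
open scoped BigOperators

namespace ThermodynamicLimit

/-! ### Particle numbers at density `n`: `N_L(n) = 2⌊n L²/2⌋` -/

/-- The (even) particle number of the `L × L` torus at density `n`: `N_L(n) = 2 ⌊n L² / 2⌋`.
[folklore] -/
def rectN (n : ℝ) (L : ℕ) : ℕ := 2 * ⌊n * (L : ℝ) ^ 2 / 2⌋₊

/-- `N_L(n) ≤ n L²`. [folklore] -/
theorem rectN_le {n : ℝ} (hn : 0 ≤ n) (L : ℕ) : (rectN n L : ℝ) ≤ n * (L : ℝ) ^ 2 := by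
  have h : (⌊n * (L : ℝ) ^ 2 / 2⌋₊ : ℝ) ≤ n * (L : ℝ) ^ 2 / 2 := Nat.floor_le (by positivity)
  rw [rectN]; push_cast; linarith

/-- `n L² < N_L(n) + 2`. [folklore] -/
theorem lt_rectN_add_two (n : ℝ) (L : ℕ) : n * (L : ℝ) ^ 2 < rectN n L + 2 := by
  have h : n * (L : ℝ) ^ 2 / 2 < ⌊n * (L : ℝ) ^ 2 / 2⌋₊ + 1 := Nat.lt_floor_add_one _
  rw [rectN]; push_cast; linarith

/-- `N_L(n) ≤ 2 L²` for `n ≤ 2`. [folklore] -/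
theorem rectN_le_two_mul {n : ℝ} (hn : 0 ≤ n) (hn2 : n ≤ 2) (L : ℕ) : rectN n L ≤ 2 * (L * L) := by
  have h := rectN_le hn L
  have h2 : n * (L : ℝ) ^ 2 ≤ 2 * (L * L : ℕ) := by push_cast; nlinarith
  exact_mod_cast h.trans h2

/-- An even integer below `x` is below `2⌊x/2⌋`: if `2m ≤ x` then `2m ≤ 2⌊x/2⌋₊`. [folklore] -/
theorem two_mul_le_rectN_aux {m : ℕ} {x : ℝ} (h : (2 * m : ℝ) ≤ x) : 2 * m ≤ 2 * ⌊x / 2⌋₊ := by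
  have : m ≤ ⌊x / 2⌋₊ := Nat.le_floor (by linarith)
  omega

/-- Exact scaling: `N_{KL}(N/L²) = K² N` for even `N` and `L ≥ 1`. [folklore] -/
theorem rectN_div_mul {L : ℕ} (hL : 1 ≤ L) (K m : ℕ) :
    rectN ((2 * m : ℕ) / (L : ℝ) ^ 2) (K * L) = K * K * (2 * m) := by
  rw [rectN]
  have hL' : (L : ℝ) ^ 2 ≠ 0 := by positivity
  have : ((2 * m : ℕ) : ℝ) / (L : ℝ) ^ 2 * ((K * L : ℕ) : ℝ) ^ 2 / 2 = ((K * K * m : ℕ) : ℝ) := by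
    push_cast; field_simp
  rw [this, Nat.floor_natCast]
  ring

/-- `N_L(n)` is monotone in the density. [folklore] -/
theorem rectN_mono {n n' : ℝ} (h : n ≤ n') (L : ℕ) : rectN n L ≤ rectN n' L := by
  unfold rectN
  gcongr

/-! ### Iterated one-particle additions -/

section Additions

variable {Λ : Type*} [LinearOrder Λ] [Fintype Λ] (G : SimpleGraph Λ) [DecidableRel G.Adj]

/-- **Adding `d` particles below density `ν < 1` (per orbital)** costs at most `K/(1-ν)` each:
`E_G(N + d) ≤ E_G(N) + d · K/(1-ν)` whenever `N + d ≤ ν · 2|Λ|`, `K = 2(2Δ+1)(2|t|+|U|)`.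
[folklore] -/
theorem groundEnergyAt_add_le {Δ : ℕ} (hΔ : ∀ x : Λ, #{y | G.Adj x y} ≤ Δ) (t U : ℝ) {ν : ℝ}
    (hν : ν < 1) {N : ℕ} : ∀ d : ℕ, ((N + d : ℕ) : ℝ) ≤ ν * (2 * Fintype.card Λ) →
      groundEnergyAt G t U (N + d) ≤ groundEnergyAt G t U N +
        d * ((2 * Δ + 1 : ℕ) * (2 * (2 * |t| + |U|)) / (1 - ν)) := by
  intro d
  induction d with
  | zero => intro _; simp
  | succ d ih =>
      intro hd
      have hK0 : (0 : ℝ) ≤ (2 * Δ + 1 : ℕ) * (2 * (2 * |t| + |U|)) := by positivity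
      have hd' : ((N + d : ℕ) : ℝ) ≤ ν * (2 * Fintype.card Λ) := by
        refine le_trans ?_ hd
        push_cast; linarith
      have h1 := ih hd'
      -- one more particle at particle number `N + d`
      have hlt : ((N + d : ℕ) : ℝ) < 2 * Fintype.card Λ := by
        have hc : (0 : ℝ) ≤ 2 * Fintype.card Λ := by positivity
        have : ((N + d : ℕ) : ℝ) + 1 ≤ ν * (2 * Fintype.card Λ) := by
          refine le_trans ?_ hd; push_cast; linarith
        nlinarith
      have hlt' : N + d < 2 * Fintype.card Λ := by exact_mod_cast hlt
      have h2 := groundEnergyAt_succ_le G hΔ t U hlt'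
      -- the cost at `N + d` is at most `K / (1 - ν)`
      have hden : (1 - ν) * (2 * Fintype.card Λ) ≤ 2 * Fintype.card Λ - ((N + d : ℕ) : ℝ) := by
        nlinarith
      have hpos : (0 : ℝ) < 2 * Fintype.card Λ - ((N + d : ℕ) : ℝ) := by linarith
      have hpos' : (0 : ℝ) < (1 - ν) * (2 * Fintype.card Λ) := by
        have : (0 : ℝ) < 2 * Fintype.card Λ := by
          have : (0 : ℝ) ≤ ((N + d : ℕ) : ℝ) := by positivity
          linarith
        exact mul_pos (by linarith) this
      have h3 : (2 * Δ + 1 : ℕ) * (2 * (2 * |t| + |U|)) * (2 * Fintype.card Λ) /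
          (2 * Fintype.card Λ - ((N + d : ℕ) : ℝ)) ≤
          (2 * Δ + 1 : ℕ) * (2 * (2 * |t| + |U|)) / (1 - ν) := by
        rw [div_le_div_iff₀ hpos (by linarith)]
        calc (2 * Δ + 1 : ℕ) * (2 * (2 * |t| + |U|)) * (2 * Fintype.card Λ) * (1 - ν)
            = (2 * Δ + 1 : ℕ) * (2 * (2 * |t| + |U|)) * ((1 - ν) * (2 * Fintype.card Λ)) := by ring
          _ ≤ (2 * Δ + 1 : ℕ) * (2 * (2 * |t| + |U|)) * (2 * Fintype.card Λ - ((N + d : ℕ) : ℝ)) :=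
              mul_le_mul_of_nonneg_left hden hK0
      have h2' : groundEnergyAt G t U (N + d + 1) ≤ groundEnergyAt G t U (N + d) +
          (2 * Δ + 1 : ℕ) * (2 * (2 * |t| + |U|)) / (1 - ν) := by
        linarith [h2, h3]
      rw [show N + (d + 1) = N + d + 1 by ring]
      have hcast : ((d + 1 : ℕ) : ℝ) = d + 1 := by push_cast; ring
      rw [hcast]
      nlinarith [h1, h2']

end Additions

/-- The one-particle cost constant of the `L × L` torus (degree `≤ 4`): adding a particle below
density `n < 2` per site costs at most `A(n) = 36(2|t| + |U|)/(2 - n)`. [folklore] -/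
theorem groundEnergyAt_square_add_le (L : ℕ) (t U : ℝ) {n : ℝ} (hn : n < 2) {N d : ℕ}
    (h : ((N + d : ℕ) : ℝ) ≤ n * (L : ℝ) ^ 2) :
    groundEnergyAt (fermionRectTorusGraph L L) t U (N + d) ≤
      groundEnergyAt (fermionRectTorusGraph L L) t U N + d * (36 * (2 * |t| + |U|) / (2 - n)) := by
  have hν : n / 2 < 1 := by linarith
  have h' : ((N + d : ℕ) : ℝ) ≤ n / 2 * (2 * Fintype.card (Fin L ×ₗ Fin L)) := by
    rw [card_rectSites]
    have h2 : n / 2 * (2 * ((L * L : ℕ) : ℝ)) = n * (L : ℝ) ^ 2 := by push_cast; ring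
    rw [h2]; exact h
  have := groundEnergyAt_add_le (fermionRectTorusGraph L L) (Δ := 4)
    (card_filter_fermionRectTorusGraph_adj_le L L) t U hν d h'
  refine this.trans (le_of_eq ?_)
  congr 1
  have h2 : (2 : ℝ) - n ≠ 0 := by linarith
  have h1 : (1 : ℝ) - n / 2 ≠ 0 := by intro h; apply h2; linarith
  push_cast
  field_simp
  ring

/-! ### The thermodynamic limit at fixed density -/

/-- `N_L(n)` is monotone in `L`. [folklore] -/
theorem rectN_mono_left {n : ℝ} (hn : 0 ≤ n) {ℓ L : ℕ} (h : ℓ ≤ L) : rectN n ℓ ≤ rectN n L := by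
  unfold rectN
  gcongr

/-- Tiling scaling of the particle numbers: `K² N_M(n) ≤ N_{KM}(n) ≤ K² N_M(n) + 2K²`. [folklore] -/
theorem sq_mul_rectN_le {n : ℝ} (hn : 0 ≤ n) (K M : ℕ) :
    K * K * rectN n M ≤ rectN n (K * M) ∧ (rectN n (K * M) : ℝ) ≤ K * K * rectN n M + 2 * (K * K) := by
  constructor
  · have h1 := rectN_le hn M
    have h2 : (2 * ((K * K * ⌊n * (M : ℝ) ^ 2 / 2⌋₊ : ℕ) : ℝ)) ≤ n * ((K * M : ℕ) : ℝ) ^ 2 := by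
      have : (2 * ((K * K * ⌊n * (M : ℝ) ^ 2 / 2⌋₊ : ℕ) : ℝ)) = (K : ℝ) * K * (rectN n M : ℝ) := by
        rw [rectN]; push_cast; ring
      rw [this]; push_cast
      calc (K : ℝ) * K * (rectN n M : ℝ) ≤ (K : ℝ) * K * (n * (M : ℝ) ^ 2) :=
            mul_le_mul_of_nonneg_left h1 (by positivity)
        _ = n * ((K : ℝ) * M) ^ 2 := by ring
    have h3 := two_mul_le_rectN_aux h2
    rw [rectN, rectN]
    calc K * K * (2 * ⌊n * (M : ℝ) ^ 2 / 2⌋₊) = 2 * (K * K * ⌊n * (M : ℝ) ^ 2 / 2⌋₊) := by ring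
      _ ≤ 2 * ⌊n * ((K * M : ℕ) : ℝ) ^ 2 / 2⌋₊ := h3
  · have h1 := rectN_le hn (K * M)
    have h2 := lt_rectN_add_two n M
    push_cast at h1 ⊢
    have hK : (0 : ℝ) ≤ (K : ℝ) * K := by positivity
    nlinarith

/-- **Existence of the thermodynamic limit of the ground-state energy density of the Hubbard
model on the two-dimensional torus at fixed density.** For every hopping `t`, repulsion `U ≥ 0`
and density `0 ≤ n < 2` (electrons per site), `E_{L×L}(2⌊nL²/2⌋)/L²` converges as `L → ∞`.
Proof: Fekete along squares (`tendsto_of_tiling_of_filling`) fed by the square tiling with the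
one-particle addition cost absorbing the rounding of the density (`≤ 2K²` extra particles at cost
`36(2|t|+U)/(2-n)` each), the complement filling, and the a priori bound `-8|t|`.
(Ruelle, *Statistical Mechanics* (1969), §2.2, §3.3.) [cite: Ruelle1969, §3.3] -/
theorem tendsto_groundEnergyAt_square_div_sq (t : ℝ) {U : ℝ} (hU : 0 ≤ U) {n : ℝ} (hn0 : 0 ≤ n)
    (hn2 : n < 2) :
    ∃ e : ℝ, Tendsto (fun L : ℕ =>
      groundEnergyAt (fermionRectTorusGraph L L) t U (rectN n L) / (L : ℝ) ^ 2) atTop (𝓝 e) := by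
  set A : ℝ := 36 * (2 * |t| + |U|) / (2 - n) with hA
  have h2n : 0 < 2 - n := by linarith
  have hA0 : 0 ≤ A := by positivity
  set M₀ : ℕ := ⌈1 / (2 - n)⌉₊ + 1 with hM₀
  have hM₀1 : 1 ≤ M₀ := Nat.le_add_left 1 _
  have hM₀n : 1 / (2 - n) ≤ M₀ := by
    have := Nat.le_ceil (1 / (2 - n))
    simp only [hM₀]; push_cast; linarith
  set b : ℕ → ℝ := fun L => groundEnergyAt (fermionRectTorusGraph L L) t U (rectN n L) / (L : ℝ) ^ 2
    with hb
  refine tendsto_of_tiling_of_filling b (C := 16 * |t| + U) (D := 2 * A) (c := 8 * |t|) hM₀1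
    (by positivity) (by positivity) ?_ ?_ ?_
  · -- a priori lower bound
    intro M hM
    have hM1 : (1 : ℝ) ≤ M := by exact_mod_cast hM₀1.trans hM
    have hE := (groundEnergyAt_rect_mem_Icc M M t hU (rectN_le_two_mul hn0 hn2.le M)).1
    simp only [hb]
    rw [le_div_iff₀ (by positivity)]
    nlinarith
  · -- tiling
    intro k M hM
    have hM1 : (1 : ℝ) ≤ M := by exact_mod_cast hM₀1.trans hM
    set K : ℕ := k + 1 with hK
    obtain ⟨hP1, hP2⟩ := sq_mul_rectN_le hn0 K M
    set P : ℕ := K * K * rectN n M with hP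
    obtain ⟨d, hd⟩ : ∃ d, rectN n (K * M) = P + d := ⟨rectN n (K * M) - P, by omega⟩
    have hPr : (P : ℝ) = K * K * (rectN n M : ℝ) := by simp only [hP]; push_cast; ring
    have hdle : (d : ℝ) ≤ 2 * (K * K) := by
      have : (rectN n (K * M) : ℝ) = P + d := by exact_mod_cast hd
      linarith
    -- additions at the big torus
    have hadd := groundEnergyAt_square_add_le (K * M) t U hn2 (N := P) (d := d)
      (by rw [← hd]; exact rectN_le hn0 (K * M))
    -- tiling with constant block particle numbers
    have htile := groundEnergyAt_square_tiling M t U k (fun _ _ => rectN n M)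
      (fun _ _ => rectN_le_two_mul hn0 hn2.le M)
    simp only [Finset.sum_const, Finset.card_univ, Fintype.card_fin, smul_eq_mul, nsmul_eq_mul]
      at htile
    have hPK : (k + 1) * ((k + 1) * rectN n M) = P := by simp only [hP, hK]; ring
    rw [hPK] at htile
    -- assemble and divide by `(K M)²`
    have hKpos : (0 : ℝ) < K := by simp only [hK]; positivity
    have hMpos : (0 : ℝ) < M := by linarith
    have hk : ((k : ℕ) : ℝ) + 1 = K := by simp only [hK]; push_cast; ring
    have hkK : (k : ℝ) ≤ K := by rw [← hk]; linarith
    have ht0 : 0 ≤ |t| := abs_nonneg t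
    set EM := groundEnergyAt (fermionRectTorusGraph M M) t U (rectN n M) with hEM
    set EK := groundEnergyAt (fermionRectTorusGraph (K * M) (K * M)) t U (P + d) with hEK
    rw [← hK] at htile
    rw [hk] at htile
    -- `E_{KM}(P+d) ≤ K² E_M + K² M (16|t| + U) + K² (2A)`
    have hdA : (d : ℝ) * A ≤ 2 * (K * K) * A := mul_le_mul_of_nonneg_right hdle hA0
    have h16 : 16 * |t| * (M : ℝ) * k * K ≤ 16 * |t| * M * K * K := by gcongr
    have hUK : 0 ≤ (K : ℝ) * K * M * U := by positivity
    have h1 : EK ≤ (K : ℝ) * K * EM + K * K * M * (16 * |t| + U) + K * K * (2 * A) := by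
      simp only [hEK, hA]
      nlinarith [hadd, htile, hdA, h16, hUK]
    -- divide
    have hbM : b M = EM / (M : ℝ) ^ 2 := rfl
    have hbK : b (K * M) = EK / ((K * M : ℕ) : ℝ) ^ 2 := by simp only [hb, hEK, hd]
    have hKM2 : (0 : ℝ) < ((K * M : ℕ) : ℝ) ^ 2 := by push_cast; positivity
    rw [hbK, hbM, div_le_iff₀ hKM2]
    have : (EM / (M : ℝ) ^ 2 + (16 * |t| + U) / M + 2 * A / (M : ℝ) ^ 2) * ((K * M : ℕ) : ℝ) ^ 2 =
        (K : ℝ) * K * EM + K * K * M * (16 * |t| + U) + K * K * (2 * A) := by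
      push_cast; field_simp
    rw [this]; exact h1
  · -- filling
    intro ℓ L hℓ hℓL
    have hℓ1 : 1 ≤ ℓ := hM₀1.trans hℓ
    have hL1 : 1 ≤ L := hℓ1.trans hℓL
    obtain ⟨r, rfl⟩ : ∃ r, L = ℓ + r := ⟨L - ℓ, by omega⟩
    set NB : ℕ := rectN n (ℓ + r) - rectN n ℓ with hNB
    have hmono := rectN_mono_left hn0 (Nat.le_add_right ℓ r)
    have hsum : rectN n ℓ + NB = rectN n (ℓ + r) := by omega
    have hNBle : NB ≤ 2 * (r * ℓ + r * (ℓ + r)) := by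
      rcases Nat.eq_zero_or_pos r with hr | hr
      · subst hr; simp [hNB]
      · have h1 := rectN_le hn0 (ℓ + r)
        have h2 := lt_rectN_add_two n ℓ
        have hNBr : (NB : ℝ) = rectN n (ℓ + r) - rectN n ℓ := by
          rw [hNB, Nat.cast_sub hmono]
        have hℓr : (1 : ℝ) ≤ r := by exact_mod_cast hr
        have hℓ' : (M₀ : ℝ) ≤ ℓ := by exact_mod_cast hℓ
        -- `(2 - n)(L² - ℓ²) ≥ (2 - n)(2ℓ + 1) ≥ 2`
        have hgap : 2 ≤ (2 - n) * (((ℓ : ℝ) + r) ^ 2 - (ℓ : ℝ) ^ 2) := by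
          have h3 : (2 : ℝ) * ℓ + 1 ≤ ((ℓ : ℝ) + r) ^ 2 - (ℓ : ℝ) ^ 2 := by nlinarith
          have h4 : 1 ≤ (2 - n) * M₀ := by
            rw [div_le_iff₀ h2n] at hM₀n; linarith
          nlinarith
        have key : (NB : ℝ) ≤ 2 * (r * ℓ + r * (ℓ + r) : ℕ) := by
          rw [hNBr]; push_cast at h1 ⊢; nlinarith
        exact_mod_cast key
    have hfill := groundEnergyAt_square_fill ℓ r t hU (rectN_le_two_mul hn0 hn2.le ℓ) hNBle
    rw [hsum] at hfill
    simp only [hb]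
    have hℓpos : (0 : ℝ) < ℓ := by exact_mod_cast hℓ1
    have hLpos : (0 : ℝ) < ((ℓ + r : ℕ) : ℝ) := by exact_mod_cast hL1
    rw [mul_div_cancel₀ _ (by positivity), mul_div_cancel₀ _ (by positivity)]
    push_cast at hfill ⊢
    have ht0 : 0 ≤ |t| := abs_nonneg t
    have hr0 : (0 : ℝ) ≤ r := by positivity
    have hG0 : (0 : ℝ) ≤ ((ℓ : ℝ) + r) ^ 2 - (ℓ : ℝ) ^ 2 := by nlinarith
    have hG : (r : ℝ) * ℓ + r * (ℓ + r) = ((ℓ : ℝ) + r) ^ 2 - (ℓ : ℝ) ^ 2 := by ring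
    rw [hG] at hfill
    nlinarith [hfill, mul_nonneg ht0 hG0, mul_nonneg hU (add_nonneg hℓpos.le hr0), mul_nonneg ht0 hr0]

/-! ### The limiting energy density `e(t, U, n)` -/

/-- **The ground-state energy density of the two-dimensional Hubbard model** at hopping `t`,
repulsion `U` and density `n` (electrons per site): `e(n) = lim_{L→∞} E_{L×L}(2⌊nL²/2⌋)/L²`, the
thermodynamic limit along the tori `(ℤ/Lℤ)²` of the canonical ground-state energy per site
(`limUnder`; the limit exists for `U ≥ 0`, `0 ≤ n < 2` by
`tendsto_groundEnergyAt_square_div_sq`). (Ruelle (1969) §3.3; Lieb–Wu 1968 / Lieb 1995 for the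
Hubbard-model usage `e(ρ)`.) [cite: Ruelle1969, §3.3] -/
def energyDensity2D (t U n : ℝ) : ℝ :=
  limUnder atTop (fun L : ℕ => groundEnergyAt (fermionRectTorusGraph L L) t U (rectN n L) / (L : ℝ) ^ 2)

/-- The defining limit: `E_{L×L}(N_L(n))/L² → e(n)` for `U ≥ 0`, `0 ≤ n < 2`. [cite: Ruelle1969, §3.3] -/
theorem tendsto_energyDensity2D (t : ℝ) {U : ℝ} (hU : 0 ≤ U) {n : ℝ} (hn0 : 0 ≤ n) (hn2 : n < 2) :
    Tendsto (fun L : ℕ => groundEnergyAt (fermionRectTorusGraph L L) t U (rectN n L) / (L : ℝ) ^ 2)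
      atTop (𝓝 (energyDensity2D t U n)) :=
  tendsto_nhds_limUnder (tendsto_groundEnergyAt_square_div_sq t hU hn0 hn2)

/-- The same limit along the square tori `fermionTorusGraph 2 L` of the tree
(`E_{torus L} = E_{L×L}`, `groundEnergyAt_fermionTorusGraph_two`). [cite: Ruelle1969, §3.3] -/
theorem tendsto_energyDensity2D_torus (t : ℝ) {U : ℝ} (hU : 0 ≤ U) {n : ℝ} (hn0 : 0 ≤ n)
    (hn2 : n < 2) :
    Tendsto (fun L : ℕ => groundEnergyAt (fermionTorusGraph 2 L) t U (rectN n L) / (L : ℝ) ^ 2)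
      atTop (𝓝 (energyDensity2D t U n)) := by
  simp_rw [groundEnergyAt_fermionTorusGraph_two]
  exact tendsto_energyDensity2D t hU hn0 hn2

/-- **The limit is an infimum (tiling lower bound at every finite size).** For `L ≥ 1` and an even
particle number `2m < 2L²`: `e(2m/L²) ≤ E_{L×L}(2m)/L² + 16|t|/L` (tile the `KL × KL` torus by
`K²` copies of the `L × L` torus, each carrying `2m` particles — no rounding — and let `K → ∞`).
[cite: Ruelle1969, §3.3] -/
theorem energyDensity2D_le (t : ℝ) {U : ℝ} (hU : 0 ≤ U) {L : ℕ} (hL : 1 ≤ L) {m : ℕ}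
    (hm : m < L * L) :
    energyDensity2D t U ((2 * m : ℕ) / (L : ℝ) ^ 2) ≤
      groundEnergyAt (fermionRectTorusGraph L L) t U (2 * m) / (L : ℝ) ^ 2 + 16 * |t| / L := by
  set n : ℝ := (2 * m : ℕ) / (L : ℝ) ^ 2 with hn
  have hLpos : (0 : ℝ) < L := by exact_mod_cast hL
  have hn0 : 0 ≤ n := by positivity
  have hn2 : n < 2 := by
    rw [hn, div_lt_iff₀ (by positivity)]
    have : ((2 * m : ℕ) : ℝ) < 2 * (L * L : ℕ) := by exact_mod_cast (by omega : 2 * m < 2 * (L * L))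
    push_cast at this ⊢; nlinarith
  have hlim := tendsto_energyDensity2D t hU hn0 hn2
  -- along the subsequence `K L`, `K = k + 1`
  have hsub : Tendsto (fun k : ℕ => (k + 1) * L) atTop atTop :=
    tendsto_atTop_mono (fun k => (Nat.le_succ k).trans (Nat.le_mul_of_pos_right _ hL)) tendsto_id
  have hlim' := hlim.comp hsub
  refine le_of_tendsto' hlim' fun k => ?_
  simp only [Function.comp_apply]
  rw [rectN_div_mul hL (k + 1) m]
  have htile := groundEnergyAt_square_tiling L t U k (fun _ _ => 2 * m) (fun _ _ => by omega)
  simp only [Finset.sum_const, Finset.card_univ, Fintype.card_fin, smul_eq_mul, nsmul_eq_mul]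
    at htile
  have hE : groundEnergyAt (fermionRectTorusGraph ((k + 1) * L) ((k + 1) * L)) t U
      ((k + 1) * (k + 1) * (2 * m)) ≤ ((k + 1 : ℕ) : ℝ) * ((k + 1 : ℕ) *
        groundEnergyAt (fermionRectTorusGraph L L) t U (2 * m)) + 16 * |t| * L * k * (k + 1) := by
    rw [show (k + 1) * (k + 1) * (2 * m) = (k + 1) * ((k + 1) * (2 * m)) by ring]
    exact htile
  have hK : (0 : ℝ) < (k : ℝ) + 1 := by positivity
  push_cast at hE ⊢
  have ht0 : 0 ≤ |t| := abs_nonneg t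
  have hk1 : (k : ℝ) ≤ k + 1 := by linarith
  have h16 : 16 * |t| * (L : ℝ) * k * (k + 1) ≤ 16 * |t| * L * (k + 1) * (k + 1) := by gcongr
  set EK := groundEnergyAt (fermionRectTorusGraph ((k + 1) * L) ((k + 1) * L)) t U
    ((k + 1) * (k + 1) * (2 * m)) with hEK
  set EL := groundEnergyAt (fermionRectTorusGraph L L) t U (2 * m) with hEL
  have h1 : EK ≤ ((k : ℝ) + 1) ^ 2 * (EL + 16 * |t| * L) := by nlinarith [hE, h16]
  calc EK / (((k : ℝ) + 1) * L) ^ 2 ≤ ((k : ℝ) + 1) ^ 2 * (EL + 16 * |t| * L) / (((k : ℝ) + 1) * L) ^ 2 :=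
        div_le_div_of_nonneg_right h1 (by positivity)
    _ = EL / (L : ℝ) ^ 2 + 16 * |t| / L := by
        field_simp

/-! ### Convexity in the density -/

/-- The one-particle addition cost constant at density `< n` per site on a square torus,
`A(n) = 36(2|t| + |U|)/(2 - n)`. [folklore] -/
def addCost (t U n : ℝ) : ℝ := 36 * (2 * |t| + |U|) / (2 - n)

/-- `A(n) ≥ 0` for `n < 2`. [folklore] -/
theorem addCost_nonneg (t U : ℝ) {n : ℝ} (hn : n < 2) : 0 ≤ addCost t U n := by
  unfold addCost
  have : 0 < 2 - n := by linarith
  positivity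

/-- `A` is monotone in the density below `2`. [folklore] -/
theorem addCost_mono (t U : ℝ) {n n' : ℝ} (h : n ≤ n') (hn' : n' < 2) : addCost t U n ≤ addCost t U n' := by
  unfold addCost
  have h1 : 0 < 2 - n' := by linarith
  exact div_le_div_of_nonneg_left (by positivity) h1 (by linarith)

end ThermodynamicLimit

end Literature.MathematicalPhysics.QuantumLattice
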